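import Summits.QuantumFields.BalabanUV.T4Continuum.Spine.NE1p.DressedMGFForm
import Summits.QuantumFields.BalabanUV.T4Continuum.Spine.NE7.QLa
import Literature.MathematicalPhysics.QuantumFieldTheory.Balaban1983to89.T4Crossover
import Literature.MathematicalPhysics.QuantumFieldTheory.Balaban1983to89.T4TermwiseResidual

/-!
# T⁴ programme, spine estimate NE1′ (node O3b/H2) — the CROSSOVER at the level of the residual binder: the summable rate of
# `TiltedMeanMatching` from a ONE-run old-component influence budget (`Spine.NE7.QLa`-shaped, per run) and a TWO-run
# young-component rate, by `T4Crossover`'s crossover sums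

Cell `pub-balaban-gaps` (YM blitz Y1, track G2), seat `ne1` gen 3 (prover-pub-balaban-gaps-ne1-g3-0), record `HOME/ne/NE1.md`
§4 rows R28–R29 (gen 3).  ADDITIVE — imports the seat's gen-2 `DressedMGFForm` (p341456 ✓: `tiltedMean`, `TiltedMeanMatching`),
seat ne7's `Spine/NE7/QLa` (p339533 ✓: the one-run shape `QLa` and `hsize_of_qla`) and the tree's `T4Crossover` (node U4′:
`summable_sum_min_pow`, `summable_sum_min_coupling`) + `T4TermwiseResidual` (for `min_add_le_add_min`) ONLY; modifies nothing.

WHAT THIS IS.  Gen 2 identified what the spine consumes of NE1′: besides the size half (gen 0, kernel) exactly the binder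
`TiltedMeanMatching l₀ T Bad F ν F′ ν′ η` with `Summable η` — on every good class `τ` and every tilt `|s| ≤ l₀` the source-tilted,
history-conditioned FIRST MOMENTS of the unit loop under run A (`K` steps) and run B (`K + 1` steps) agree within `η K`
(`DressedMGFForm.core_of_mgfForm`, `hybridNE7_of_mgfForm`).  Seats ne1 and ne7 AGREED (HOME/INBOX [NE1-G2-XREF-NE7] (Q2),
[NE7-G3-ROW v3] (vii)) on the known SUFFICIENT route to `Summable η`: a ONE-run budget for the influence of OLD components
(born `K − j` levels below the unit scale: the loop is UV-irrelevant, rate `a^{K−j}`, `a < 1`) + a TWO-run rate for YOUNG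
components (the runs have converged `j` steps after the cutoff: `θ^j` against the multiplicity `Λ^{K−j}`) + the undressed
matching of the base terms — booked, never typed.  This file is that booking in the kernel:
* §1 [pure finite sums] the SCALE-RESOLVED LEDGER INEQUALITY: if two numbers decompose over a common finite ledger of slots
  `X` with scales `sc X ≤ K` as base + Σ influences, then `|m_B − m_A| ≤ |b_B − b_A| + Σ_{j ≤ K} min(U j, V j)` where `U j`
  majorises the slice sums of `|Δ_A| + |Δ_B|` (one-run) and `V j` those of `|Δ_B − Δ_A|` (two-run)
  (`abs_sub_le_ledger`); the range sum is the antidiagonal sum of `T4Crossover` (`sum_range_min_eq_sum_antidiagonal`).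
* §2 [hypothesis shapes, NOT PRINTED] `ScaleLedger` (the decompositions of both runs' tilted means + base matching within
  `w K`), `OldInfluenceProfile` (ONE run: the scale-`j` slice of the influences is `≤ vol·u K j`), `YoungInfluenceRate`
  (TWO runs: the slice of the influence DIFFERENCES is `≤ vol·C·θ^j·Λ^{K−j}`); the theorem `tiltedMeanMatching_of_profile`:
  these give `TiltedMeanMatching … (profileEta vol uA uB C θ Λ w)` with
  `profileEta … K = w K + vol·Σ_{j+n=K} min(uA K j + uB K j, C θ^j Λ^n)`.
* §3 [the two printed-shape profiles, summable by `T4Crossover`] GEOMETRIC: `OldInfluenceBudget … Δ vol E a` := the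
  one-run budget IS `Spine.NE7.QLa (wf K τ) (sc K) (Δ K t τ s) 0 K vol E a` — (QL-a) read in the consumer's INTEGRATED
  currency (influences on a tilted first moment instead of `t`-discrepancies of field-independent constants) — and two runs'
  budgets give the added profile `(E_A + E_B)·a^{K−j}` by ne7's `hsize_of_qla` verbatim (`slice_add_le_of_budgets`; one budget
  alone is the profile `E·a^{K−j}`, `oldInfluenceProfile_of_budget`); with the
  young rate, `TiltedMeanMatching … (crossoverEta vol E_A E_B C a θ Λ w)`, `crossoverEta … K = w K + vol·max(E_A + E_B, C)·
  Σ_{j+n=K} min(a^n, θ^jΛ^n)` (`tiltedMeanMatching_of_budget`), SUMMABLE for `0 < a < 1`, `0 < θ < 1`, `θ ≤ Λ`, `Summable w`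
  (`summable_crossoverEta` ⇐ `T4Crossover.summable_sum_min_pow`).  MIXED (geometric + coupling power, the birth-scale
  booking of the re-linearised first-order channel, NE7.md v3 §4quater (iv) / NE1.md R28): if `uA K j + uB K j ≤ E·a^{K−j} +
  R₁·(gs K j)^{κ₀}` then `profileEta ≤ mixedEta` (`profileEta_le_mixedEta`) and `mixedEta` is summable under the LOWER half
  of the endpoint running `Step.Discrete031` and `κ₀ > 4` (`summable_mixedEta` ⇐ `T4Crossover.summable_sum_min_coupling`).
* §4 SANITY (non-vacuity): one-point field spaces, one class, one slot of scale 0 with influence `a^K` — all four shapes hold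
  at once and `tiltedMeanMatching_of_budget` returns the true, non-trivial `|a^K − 0| ≤ crossoverEta 1 0 1 1 a θ Λ 0 K`.
So the residue of NE1′ that is neither kernel nor another row's is named in the consumer's currency: per run, the influence
data `Δ` of a `ScaleLedger` and its `OldInfluenceBudget` (a = L⁻¹ by birth scale ∕ L⁻² by regeneration scale in the covariance
power counting of NE1.md R28; NOT certified), next to gen 2's two-run `TiltedMeanMatching`.

HONEST FRAMING.  Hypothesis SHAPES over abstract data + finite-sum∕series bookkeeping ([folklore]); NOTHING of Bałaban's is
asserted or instantiated (which ledger — Bałaban's localization domains with their R-histories — produces a `ScaleLedger` for the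
class-conditioned tilted means is row NE1′'s OBJECT-bound content behind NODE O; the profiles are the rows' estimates NE1′ (old,
one-run) and NE5∕NE9 (young, two-run), none proved).  (QL-a) ∕ `QLa` is NOT IN PRINT for the d = 4 non-abelian model
([Balaban1989LargeFieldII] p. 356 defers observables).  NE1′ NOT proved; spine 0∕9; (B) 0∕13; one fixed finite T⁴ — NOT ℝ⁴, NOT
infinite volume, NOT a mass gap, NOT Clay.  0 sorry.
-/

noncomputable section

open Finset MeasureTheory
open scoped BigOperators

namespace Summit.QuantumFields.BalabanUV.T4Continuum.NE1p.TiltedMeanCrossover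

open Summit.QuantumFields.BalabanUV.T4Continuum.NE1p.DressedMGFForm (tiltedMean TiltedMeanMatching)
open Summit.QuantumFields.BalabanUV.T4Continuum.Spine.NE7 (QLa hsize_of_qla)
open Literature.MathematicalPhysics.QuantumFieldTheory.Balaban1983to89

/-! ## §1 Two numbers over one scale-resolved ledger: the crossover inequality (pure finite sums) -/

section Ledger

variable {D : Type*}

/-- `|y − x| ≤ |x| + |y|` (triangle inequality, the order of the summands as the one-run slice sums carry them). [folklore] -/
theorem abs_sub_le_abs_add_abs (x y : ℝ) : |y - x| ≤ |x| + |y| :=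
  abs_le.mpr ⟨by linarith [neg_abs_le y, le_abs_self x], by linarith [le_abs_self y, neg_abs_le x]⟩

/-- SLICE-WISE MINIMUM.  Slots `X ∈ wf` with scales `sc X ≤ K`; if for every `j ≤ K` the scale-`j` slice sum of
`|ΔA X| + |ΔB X|` is at most `U j` (ONE-run budgets of the two runs, added) and that of `|ΔB X − ΔA X|` at most `V j` (TWO-run
rate), then `Σ_X |ΔB X − ΔA X| ≤ Σ_{j ≤ K} min(U j, V j)` — each slice pays the cheaper of its two prices. [folklore] -/
theorem sum_abs_sub_le_sum_min {wf : Finset D} {sc : D → ℕ} {ΔA ΔB : D → ℝ} {K : ℕ} {U V : ℕ → ℝ}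
    (hsc : ∀ X ∈ wf, sc X ≤ K) (hold : ∀ j ≤ K, ∑ X ∈ wf with sc X = j, (|ΔA X| + |ΔB X|) ≤ U j)
    (hyoung : ∀ j ≤ K, ∑ X ∈ wf with sc X = j, |ΔB X - ΔA X| ≤ V j) :
    ∑ X ∈ wf, |ΔB X - ΔA X| ≤ ∑ j ∈ range (K + 1), min (U j) (V j) := by
  have hmaps : ∀ X ∈ wf, sc X ∈ range (K + 1) := fun X hX => mem_range.mpr (Nat.lt_succ_of_le (hsc X hX))
  rw [← sum_fiberwise_of_maps_to hmaps]
  refine sum_le_sum fun j hj => ?_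
  have hjK : j ≤ K := Nat.le_of_lt_succ (mem_range.mp hj)
  exact le_min ((sum_le_sum fun X _ => abs_sub_le_abs_add_abs (ΔA X) (ΔB X)).trans (hold j hjK)) (hyoung j hjK)

/-- **THE SCALE-RESOLVED LEDGER INEQUALITY.**  Two numbers `mA = bA + Σ_X ΔA X`, `mB = bB + Σ_X ΔB X` over one finite ledger
`wf` with scales `sc X ≤ K`; one-run slice budgets `U`, two-run slice rate `V` as in `sum_abs_sub_le_sum_min`.  Then
`|mB − mA| ≤ |bB − bA| + Σ_{j ≤ K} min(U j, V j)`. [folklore] -/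
theorem abs_sub_le_ledger {wf : Finset D} {sc : D → ℕ} {ΔA ΔB : D → ℝ} {bA bB mA mB : ℝ} {K : ℕ} {U V : ℕ → ℝ}
    (hA : mA = bA + ∑ X ∈ wf, ΔA X) (hB : mB = bB + ∑ X ∈ wf, ΔB X) (hsc : ∀ X ∈ wf, sc X ≤ K)
    (hold : ∀ j ≤ K, ∑ X ∈ wf with sc X = j, (|ΔA X| + |ΔB X|) ≤ U j)
    (hyoung : ∀ j ≤ K, ∑ X ∈ wf with sc X = j, |ΔB X - ΔA X| ≤ V j) :
    |mB - mA| ≤ |bB - bA| + ∑ j ∈ range (K + 1), min (U j) (V j) := by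
  have h : mB - mA = (bB - bA) + ∑ X ∈ wf, (ΔB X - ΔA X) := by rw [hA, hB, sum_sub_distrib]; ring
  rw [h]
  exact (abs_add_le _ _).trans
    (add_le_add le_rfl ((abs_sum_le_sum_abs _ _).trans (sum_abs_sub_le_sum_min hsc hold hyoung)))

/-- The range sum of §1 is `T4Crossover`'s antidiagonal sum (`n = K − j` remaining scales; no truncated subtraction survives on
the right). [folklore] -/
theorem sum_range_min_eq_sum_antidiagonal (f : ℕ → ℕ → ℝ) (K : ℕ) :
    ∑ j ∈ range (K + 1), f j (K - j) = ∑ p ∈ antidiagonal K, f p.1 p.2 :=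
  (Finset.Nat.sum_antidiagonal_eq_sum_range_succ f K).symm

end Ledger

/-! ## §2 The shapes on the consumer's data and the matching with a general one-run profile -/

section Matching

variable {ι D : Type*} [DecidableEq ι] {Ω Ω' : ℕ → Type*} [∀ K, MeasurableSpace (Ω K)] [∀ K, MeasurableSpace (Ω' K)]

/-- **SCALE LEDGER** (hypothesis shape, NOT PRINTED).  For every number of steps `K`, source `|t| ≤ l₀`, class `τ` good at `t`
and tilt `|s| ≤ l₀`, the two runs' source-tilted history-conditioned first moments of the loop (`DressedMGFForm.tiltedMean`)
decompose over ONE finite ledger `wf K τ` of slots `X` (in the application: localization domains ∕ R-components of the class,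
aligned by physical scale) with scales `sc K X ≤ K` (the step at which the slot is born; `K − sc K X` = levels below the unit
scale) into a BASE term plus per-slot INFLUENCES, `tiltedMean = b + Σ_X Δ X`, the base terms of the two runs agreeing within
`w K` (undressed ∕ last-step matching — another row's).  Which ledger realises this for Bałaban's runs is NODE O's business;
nothing is asserted.  Run B's extra (finest) level has no counterpart in run A: its components are booked as slots of scale `0`
with `ΔA = 0` (run B's `OldInfluenceBudget` then prices them at `E·a^K`) or inside the base term.  DEGENERATE INSTANCE, stated
once: with the EMPTY ledger the shape says only `|Δ tilted means| ≤ w K`, i.e.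
the whole matching is charged to the base width — the split base ∕ old ∕ young carries information solely through WHICH producer
supplies which piece (rows NE7-core ∕ NE1′ ∕ NE5–NE9), exactly as for every other shape of the hybrid ledger. [folklore] -/
def ScaleLedger (l₀ : ℝ) (T : ℕ → Finset ι) (Bad : ℕ → ℝ → Finset ι) (F : ∀ K, Ω K → ℝ)
    (ν : ∀ K, ι → Measure (Ω K)) (F' : ∀ K, Ω' K → ℝ) (ν' : ∀ K, ι → Measure (Ω' K)) (wf : ℕ → ι → Finset D)
    (sc : ℕ → D → ℕ) (bA bB : ℕ → ℝ → ι → ℝ → ℝ) (ΔA ΔB : ℕ → ℝ → ι → ℝ → D → ℝ) (w : ℕ → ℝ) : Prop :=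
  ∀ K (t : ℝ), |t| ≤ l₀ → ∀ τ ∈ T K \ Bad K t, ∀ s : ℝ, |s| ≤ l₀ →
    (∀ X ∈ wf K τ, sc K X ≤ K) ∧
    tiltedMean (F K) (ν K τ) s = bA K t τ s + ∑ X ∈ wf K τ, ΔA K t τ s X ∧
    tiltedMean (F' K) (ν' K τ) s = bB K t τ s + ∑ X ∈ wf K τ, ΔB K t τ s X ∧
    |bB K t τ s - bA K t τ s| ≤ w K

/-- **OLD-COMPONENT INFLUENCE PROFILE, ONE RUN** (hypothesis shape, NOT PRINTED — the NE1′ estimate in the consumer's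
currency).  For every `K`, `|t| ≤ l₀`, good `τ`, `|s| ≤ l₀` and every scale `j ≤ K`: the slice sum of the absolute influences of
the scale-`j` slots on this run's tilted first moment is at most `vol·u K j`.  The profile `u` is free here; §3 takes it
geometric in the age (`E·a^{K−j}` = `Spine.NE7.QLa`) or mixed with a coupling power. [folklore] -/
def OldInfluenceProfile (l₀ : ℝ) (T : ℕ → Finset ι) (Bad : ℕ → ℝ → Finset ι) (wf : ℕ → ι → Finset D)
    (sc : ℕ → D → ℕ) (Δ : ℕ → ℝ → ι → ℝ → D → ℝ) (vol : ℝ) (u : ℕ → ℕ → ℝ) : Prop :=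
  ∀ K (t : ℝ), |t| ≤ l₀ → ∀ τ ∈ T K \ Bad K t, ∀ s : ℝ, |s| ≤ l₀ →
    ∀ j ≤ K, ∑ X ∈ wf K τ with sc K X = j, |Δ K t τ s X| ≤ vol * u K j

/-- **YOUNG-COMPONENT RATE, TWO RUNS** (hypothesis shape, NOT PRINTED — the NE5∕NE9-type estimate in the consumer's currency).
For every `K`, `|t| ≤ l₀`, good `τ`, `|s| ≤ l₀` and `j ≤ K`: the slice sum of the absolute DIFFERENCES of the two runs'
influences of the scale-`j` slots is at most `vol·C·θ^j·Λ^{K−j}` (rate `θ^j` in the steps since the cutoff, against the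
multiplicity `Λ^{K−j}` of scale-`j` slots per unit volume). [folklore] -/
def YoungInfluenceRate (l₀ : ℝ) (T : ℕ → Finset ι) (Bad : ℕ → ℝ → Finset ι) (wf : ℕ → ι → Finset D)
    (sc : ℕ → D → ℕ) (ΔA ΔB : ℕ → ℝ → ι → ℝ → D → ℝ) (vol C θ Λ : ℝ) : Prop :=
  ∀ K (t : ℝ), |t| ≤ l₀ → ∀ τ ∈ T K \ Bad K t, ∀ s : ℝ, |s| ≤ l₀ →
    ∀ j ≤ K, ∑ X ∈ wf K τ with sc K X = j, |ΔB K t τ s X - ΔA K t τ s X| ≤ vol * (C * (θ ^ j * Λ ^ (K - j)))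

/-- The PROFILE MAJORANT of the tilted-mean discrepancy at `K` steps: base width plus `vol ×` the crossover sum of
`min(uA K j + uB K j, C θ^j Λ^n)` over `j + n = K`. [folklore] -/
def profileEta (vol : ℝ) (uA uB : ℕ → ℕ → ℝ) (C θ Λ : ℝ) (w : ℕ → ℝ) (K : ℕ) : ℝ :=
  w K + vol * ∑ p ∈ antidiagonal K, min (uA K p.1 + uB K p.1) (C * (θ ^ p.1 * Λ ^ p.2))

variable {l₀ vol : ℝ} {T : ℕ → Finset ι} {Bad : ℕ → ℝ → Finset ι} {F : ∀ K, Ω K → ℝ} {ν : ∀ K, ι → Measure (Ω K)}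
  {F' : ∀ K, Ω' K → ℝ} {ν' : ∀ K, ι → Measure (Ω' K)} {wf : ℕ → ι → Finset D} {sc : ℕ → D → ℕ}
  {bA bB : ℕ → ℝ → ι → ℝ → ℝ} {ΔA ΔB : ℕ → ℝ → ι → ℝ → D → ℝ} {w : ℕ → ℝ}

/-- **`TiltedMeanMatching` FROM A SCALE LEDGER, TWO ONE-RUN PROFILES AND THE YOUNG RATE** (`vol ≥ 0`):
`TiltedMeanMatching l₀ T Bad F ν F′ ν′ (profileEta vol uA uB C θ Λ w)`.  Each scale slice pays the cheaper of its one-run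
price (the two runs' influences are separately small — OLD slots) and its two-run price (the influences agree — YOUNG slots).
[folklore] -/
theorem tiltedMeanMatching_of_profile {uA uB : ℕ → ℕ → ℝ} {C θ Λ : ℝ}
    (hL : ScaleLedger l₀ T Bad F ν F' ν' wf sc bA bB ΔA ΔB w) (hA : OldInfluenceProfile l₀ T Bad wf sc ΔA vol uA)
    (hB : OldInfluenceProfile l₀ T Bad wf sc ΔB vol uB) (hY : YoungInfluenceRate l₀ T Bad wf sc ΔA ΔB vol C θ Λ)
    (hvol : 0 ≤ vol) : TiltedMeanMatching l₀ T Bad F ν F' ν' (profileEta vol uA uB C θ Λ w) := by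
  intro K t ht τ hτ s hs
  obtain ⟨hsc, hdA, hdB, hb⟩ := hL K t ht τ hτ s hs
  have hold : ∀ j ≤ K, ∑ X ∈ wf K τ with sc K X = j, (|ΔA K t τ s X| + |ΔB K t τ s X|)
      ≤ vol * (uA K j + uB K j) := fun j hj => by
    rw [sum_add_distrib, mul_add]
    exact add_le_add (hA K t ht τ hτ s hs j hj) (hB K t ht τ hτ s hs j hj)
  have h := abs_sub_le_ledger hdA hdB hsc hold (hY K t ht τ hτ s hs)
  refine h.trans (add_le_add hb ?_)
  rw [show (fun j => min (vol * (uA K j + uB K j)) (vol * (C * (θ ^ j * Λ ^ (K - j)))))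
      = fun j => vol * min (uA K j + uB K j) (C * (θ ^ j * Λ ^ (K - j))) from
      funext fun j => (mul_min_of_nonneg _ _ hvol).symm, ← mul_sum,
    sum_range_min_eq_sum_antidiagonal (fun j n => min (uA K j + uB K j) (C * (θ ^ j * Λ ^ n))) K]

end Matching

/-! ## §3 The two printed-shape profiles: geometric (= `Spine.NE7.QLa` per run) and mixed; summability by `T4Crossover` -/

section Profiles

variable {ι D : Type*} [DecidableEq ι] {Ω Ω' : ℕ → Type*} [∀ K, MeasurableSpace (Ω K)] [∀ K, MeasurableSpace (Ω' K)]

/-- **OLD-COMPONENT INFLUENCE BUDGET, ONE RUN, GEOMETRIC = (QL-a) IN THE CONSUMER'S CURRENCY** (hypothesis shape, NOT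
PRINTED).  For every `K`, `|t| ≤ l₀`, good `τ`, `|s| ≤ l₀`: ne7's one-run shape `Spine.NE7.QLa` ON THE INFLUENCE DATA with
reference values `0` — `Σ_{sc X = j} |Δ K t τ s X − 0| ≤ vol·E·a^{K−j}` for all `j ≤ K`.  The load-bearing letter is `a < 1`
(UV-irrelevance of the unit loop against the multiplicity of scale-`j` slots; in the covariance power counting of NE1.md §4 R28:
`a = L⁻¹` with slots indexed by birth scale, `L⁻²` by regeneration scale — NOT certified). [folklore] -/
def OldInfluenceBudget (l₀ : ℝ) (T : ℕ → Finset ι) (Bad : ℕ → ℝ → Finset ι) (wf : ℕ → ι → Finset D)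
    (sc : ℕ → D → ℕ) (Δ : ℕ → ℝ → ι → ℝ → D → ℝ) (vol E a : ℝ) : Prop :=
  ∀ K (t : ℝ), |t| ≤ l₀ → ∀ τ ∈ T K \ Bad K t, ∀ s : ℝ, |s| ≤ l₀ →
    QLa (wf K τ) (sc K) (Δ K t τ s) (fun _ => 0) K vol E a

/-- The CROSSOVER MAJORANT for geometric one-run budgets `E_A`, `E_B` (ratio `a`) and the young rate (`C`, `θ`, `Λ`):
`crossoverEta … K = w K + vol·max(E_A + E_B, C)·Σ_{j+n=K} min(a^n, θ^j Λ^n)` — `T4Crossover`'s crossover sum (i). [folklore] -/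
def crossoverEta (vol EA EB C a θ Λ : ℝ) (w : ℕ → ℝ) (K : ℕ) : ℝ :=
  w K + vol * max (EA + EB) C * ∑ p ∈ antidiagonal K, min (a ^ p.2) (θ ^ p.1 * Λ ^ p.2)

variable {l₀ vol : ℝ} {T : ℕ → Finset ι} {Bad : ℕ → ℝ → Finset ι} {F : ∀ K, Ω K → ℝ} {ν : ∀ K, ι → Measure (Ω K)}
  {F' : ∀ K, Ω' K → ℝ} {ν' : ∀ K, ι → Measure (Ω' K)} {wf : ℕ → ι → Finset D} {sc : ℕ → D → ℕ}
  {bA bB : ℕ → ℝ → ι → ℝ → ℝ} {ΔA ΔB : ℕ → ℝ → ι → ℝ → D → ℝ} {w : ℕ → ℝ}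

/-- A geometric budget is the profile `u K j = E·a^{K−j}` (unfolding `QLa` with reference `0`). [folklore] -/
theorem oldInfluenceProfile_of_budget {Δ : ℕ → ℝ → ι → ℝ → D → ℝ} {E a : ℝ}
    (h : OldInfluenceBudget l₀ T Bad wf sc Δ vol E a) :
    OldInfluenceProfile l₀ T Bad wf sc Δ vol (fun K j => E * a ^ (K - j)) := by
  intro K t ht τ hτ s hs j hj
  have h1 := h K t ht τ hτ s hs j hj
  simp only [sub_zero] at h1
  exact h1

/-- **TWO ONE-RUN BUDGETS GIVE THE ADDED PROFILE BY ne7's `hsize_of_qla` VERBATIM**: the slice sums of `|ΔA| + |ΔB|` are at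
most `vol·(E_A + E_B)·a^{K−j}` — the two-run binder of route 1's END is two one-run copies, here on influence data. [folklore] -/
theorem slice_add_le_of_budgets {EA EB a : ℝ} (hA : OldInfluenceBudget l₀ T Bad wf sc ΔA vol EA a)
    (hB : OldInfluenceBudget l₀ T Bad wf sc ΔB vol EB a) {K : ℕ} {t : ℝ} (ht : |t| ≤ l₀) {τ : ι}
    (hτ : τ ∈ T K \ Bad K t) {s : ℝ} (hs : |s| ≤ l₀) :
    ∀ j ≤ K, ∑ X ∈ wf K τ with sc K X = j, (|ΔA K t τ s X| + |ΔB K t τ s X|) ≤ vol * ((EA + EB) * a ^ (K - j)) := by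
  have h := hsize_of_qla (hA K t ht τ hτ s hs) (hB K t ht τ hτ s hs)
  simpa only [sub_zero] using h

/-- One slice: `min(vol·(E·x), vol·(C·y)) ≤ vol·max(E, C)·min(x, y)` for `vol, x, y ≥ 0`. [folklore] -/
theorem min_mul_le_mul_max_min {vol E C x y : ℝ} (hvol : 0 ≤ vol) (hx : 0 ≤ x) (hy : 0 ≤ y) :
    min (vol * (E * x)) (vol * (C * y)) ≤ vol * max E C * min x y := by
  rcases le_total x y with hxy | hxy
  · rw [min_eq_left hxy]
    calc min (vol * (E * x)) (vol * (C * y)) ≤ vol * (E * x) := min_le_left _ _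
      _ ≤ vol * (max E C * x) := mul_le_mul_of_nonneg_left (mul_le_mul_of_nonneg_right (le_max_left _ _) hx) hvol
      _ = vol * max E C * x := by ring
  · rw [min_eq_right hxy]
    calc min (vol * (E * x)) (vol * (C * y)) ≤ vol * (C * y) := min_le_right _ _
      _ ≤ vol * (max E C * y) := mul_le_mul_of_nonneg_left (mul_le_mul_of_nonneg_right (le_max_right _ _) hy) hvol
      _ = vol * max E C * y := by ring

/-- **`TiltedMeanMatching` FROM A SCALE LEDGER, TWO GEOMETRIC ONE-RUN BUDGETS (`QLa`) AND THE YOUNG RATE**: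
`TiltedMeanMatching l₀ T Bad F ν F′ ν′ (crossoverEta vol E_A E_B C a θ Λ w)` for `vol, a, θ, Λ ≥ 0`. [folklore] -/
theorem tiltedMeanMatching_of_budget {EA EB C a θ Λ : ℝ}
    (hL : ScaleLedger l₀ T Bad F ν F' ν' wf sc bA bB ΔA ΔB w) (hA : OldInfluenceBudget l₀ T Bad wf sc ΔA vol EA a)
    (hB : OldInfluenceBudget l₀ T Bad wf sc ΔB vol EB a) (hY : YoungInfluenceRate l₀ T Bad wf sc ΔA ΔB vol C θ Λ)
    (hvol : 0 ≤ vol) (ha : 0 ≤ a) (hθ : 0 ≤ θ) (hΛ : 0 ≤ Λ) :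
    TiltedMeanMatching l₀ T Bad F ν F' ν' (crossoverEta vol EA EB C a θ Λ w) := by
  intro K t ht τ hτ s hs
  obtain ⟨hsc, hdA, hdB, hb⟩ := hL K t ht τ hτ s hs
  have h := abs_sub_le_ledger hdA hdB hsc (slice_add_le_of_budgets hA hB ht hτ hs) (hY K t ht τ hτ s hs)
  refine h.trans (add_le_add hb ?_)
  calc ∑ j ∈ range (K + 1), min (vol * ((EA + EB) * a ^ (K - j))) (vol * (C * (θ ^ j * Λ ^ (K - j))))
      ≤ ∑ j ∈ range (K + 1), vol * max (EA + EB) C * min (a ^ (K - j)) (θ ^ j * Λ ^ (K - j)) :=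
        sum_le_sum fun j _ => min_mul_le_mul_max_min hvol (pow_nonneg ha _) (mul_nonneg (pow_nonneg hθ _) (pow_nonneg hΛ _))
    _ = vol * max (EA + EB) C * ∑ p ∈ antidiagonal K, min (a ^ p.2) (θ ^ p.1 * Λ ^ p.2) := by
        rw [← mul_sum, sum_range_min_eq_sum_antidiagonal (fun j n => min (a ^ n) (θ ^ j * Λ ^ n)) K]

/-- **THE GEOMETRIC CROSSOVER MAJORANT IS SUMMABLE** (`0 < a < 1`, `0 < θ < 1`, `θ ≤ Λ`, `Summable w`) — `T4Crossover`'s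
crossover lemma (i) `summable_sum_min_pow` (node U4′) plus the base widths.  With `tiltedMeanMatching_of_budget` this is the
`Summable η` the consumer `DressedMGFForm.hybridNE7_of_mgfForm` asks of the residual binder. [folklore] -/
theorem summable_crossoverEta {EA EB C a θ Λ : ℝ} (ha0 : 0 < a) (ha1 : a < 1) (hθ : 0 < θ) (hθ1 : θ < 1)
    (hθΛ : θ ≤ Λ) (hw : Summable w) : Summable (crossoverEta vol EA EB C a θ Λ w) :=
  hw.add ((T4Crossover.summable_sum_min_pow ha0 ha1 hθ hθ1 hθΛ).mul_left (vol * max (EA + EB) C))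

/-- The MIXED MAJORANT: geometric old terms (`E`, ratio `a`) AND coupling-power old terms (`R₁·(gs K j)^{κ₀}`, the printed
(2.44)-type profile, here the birth-scale booking of the re-linearised first-order channel) against the young rate:
`mixedEta … K = w K + vol·(max(E, C)·Σ_{j+n=K} min(a^n, θ^jΛ^n) + Σ_{j+n=K} min(R₁ (gs K j)^{κ₀}, C θ^j Λ^n))`. [folklore] -/
def mixedEta (vol E a R₁ C θ Λ : ℝ) (κ₀ : ℕ) (gs : ℕ → ℕ → ℝ) (w : ℕ → ℝ) (K : ℕ) : ℝ :=
  w K + vol * (max E C * ∑ p ∈ antidiagonal K, min (a ^ p.2) (θ ^ p.1 * Λ ^ p.2)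
    + ∑ p ∈ antidiagonal K, min (R₁ * gs K p.1 ^ κ₀) (C * θ ^ p.1 * Λ ^ p.2))

/-- **A MIXED PROFILE IS DOMINATED BY THE MIXED MAJORANT**: if `uA K j + uB K j ≤ E·a^{K−j} + R₁·(gs K j)^{κ₀}` for `j ≤ K`
(constants and couplings nonnegative, `vol ≥ 0`), then `profileEta vol uA uB C θ Λ w K ≤ mixedEta vol E a R₁ C θ Λ κ₀ gs w K`.
[folklore] -/
theorem profileEta_le_mixedEta {uA uB : ℕ → ℕ → ℝ} {E a R₁ C θ Λ : ℝ} {κ₀ : ℕ} {gs : ℕ → ℕ → ℝ}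
    (hu : ∀ K j, j ≤ K → uA K j + uB K j ≤ E * a ^ (K - j) + R₁ * gs K j ^ κ₀)
    (hvol : 0 ≤ vol) (hE : 0 ≤ E) (ha : 0 ≤ a) (hR₁ : 0 ≤ R₁) (hgs : ∀ K j, j ≤ K → 0 ≤ gs K j) (hC : 0 ≤ C)
    (hθ : 0 ≤ θ) (hΛ : 0 ≤ Λ) (K : ℕ) :
    profileEta vol uA uB C θ Λ w K ≤ mixedEta vol E a R₁ C θ Λ κ₀ gs w K := by
  unfold profileEta mixedEta
  refine add_le_add le_rfl (mul_le_mul_of_nonneg_left ?_ hvol)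
  rw [mul_sum, ← sum_add_distrib]
  refine sum_le_sum fun p hp => ?_
  have hj : p.1 ≤ K := by have := mem_antidiagonal.mp hp; omega
  have hKj : K - p.1 = p.2 := by have := mem_antidiagonal.mp hp; omega
  have hz : 0 ≤ C * (θ ^ p.1 * Λ ^ p.2) := mul_nonneg hC (mul_nonneg (pow_nonneg hθ _) (pow_nonneg hΛ _))
  have hx : 0 ≤ E * a ^ p.2 := mul_nonneg hE (pow_nonneg ha _)
  have hy : 0 ≤ R₁ * gs K p.1 ^ κ₀ := mul_nonneg hR₁ (pow_nonneg (hgs K p.1 hj) _)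
  calc min (uA K p.1 + uB K p.1) (C * (θ ^ p.1 * Λ ^ p.2))
      ≤ min (E * a ^ p.2 + R₁ * gs K p.1 ^ κ₀) (C * (θ ^ p.1 * Λ ^ p.2)) :=
        min_le_min_right _ (by simpa only [hKj] using hu K p.1 hj)
    _ ≤ min (E * a ^ p.2) (C * (θ ^ p.1 * Λ ^ p.2)) + min (R₁ * gs K p.1 ^ κ₀) (C * (θ ^ p.1 * Λ ^ p.2)) :=
        T4TermwiseResidual.min_add_le_add_min hx hy hz
    _ ≤ max E C * min (a ^ p.2) (θ ^ p.1 * Λ ^ p.2) + min (R₁ * gs K p.1 ^ κ₀) (C * θ ^ p.1 * Λ ^ p.2) := by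
        refine add_le_add ?_ (by rw [mul_assoc])
        have h := min_mul_le_mul_max_min (vol := 1) (E := E) (C := C) zero_le_one (pow_nonneg ha p.2)
          (mul_nonneg (pow_nonneg hθ p.1) (pow_nonneg hΛ p.2))
        simpa only [one_mul] using h

/-- **THE MIXED MAJORANT IS SUMMABLE** under `T4Crossover`'s hypotheses: `0 < a < 1`, `0 < θ < 1`, `θ ≤ Λ`, the LOWER half
of the endpoint running `Step.Discrete031 b β′ K (g K) (gs K)` for every `K` (`b > 0`, nonnegative couplings), `R₁, C ≥ 0`,
`κ₀ > 4`, `Summable w` — crossover lemmas (i) and (ii) (`summable_sum_min_pow`, `summable_sum_min_coupling`, the cut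
parameter from `exists_recentRate_lt_one`). [folklore] -/
theorem summable_mixedEta {E a R₁ C θ Λ b β' : ℝ} {κ₀ : ℕ} {g : ℕ → ℝ} {gs : ℕ → ℕ → ℝ}
    (ha0 : 0 < a) (ha1 : a < 1) (hθ : 0 < θ) (hθ1 : θ < 1) (hθΛ : θ ≤ Λ) (hb : 0 < b)
    (h031 : ∀ K, Step.Discrete031 b β' K (g K) (gs K)) (hpos : ∀ K k, k ≤ K → 0 ≤ gs K k) (hR₁ : 0 ≤ R₁)
    (hC : 0 ≤ C) (hκ : 4 < κ₀) (hw : Summable w) : Summable (mixedEta vol E a R₁ C θ Λ κ₀ gs w) := by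
  obtain ⟨σ, hσ, hq⟩ := T4Crossover.exists_recentRate_lt_one hθ hθ1 hθΛ
  exact hw.add ((((T4Crossover.summable_sum_min_pow ha0 ha1 hθ hθ1 hθΛ).mul_left (max E C)).add
    (T4Crossover.summable_sum_min_coupling hb h031 hpos hR₁ hC hθ hθΛ hσ hq hκ)).mul_left vol)

/-- **`TiltedMeanMatching` WITH THE MIXED MAJORANT**: a scale ledger, one-run profiles dominated by `E·a^{K−j} + R₁·(gs K j)^{κ₀}`,
and the young rate give `TiltedMeanMatching … (mixedEta vol E a R₁ C θ Λ κ₀ gs w)` — summable by `summable_mixedEta`.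
[folklore] -/
theorem tiltedMeanMatching_of_mixed {uA uB : ℕ → ℕ → ℝ} {E a R₁ C θ Λ : ℝ} {κ₀ : ℕ} {gs : ℕ → ℕ → ℝ}
    (hL : ScaleLedger l₀ T Bad F ν F' ν' wf sc bA bB ΔA ΔB w) (hA : OldInfluenceProfile l₀ T Bad wf sc ΔA vol uA)
    (hB : OldInfluenceProfile l₀ T Bad wf sc ΔB vol uB) (hY : YoungInfluenceRate l₀ T Bad wf sc ΔA ΔB vol C θ Λ)
    (hu : ∀ K j, j ≤ K → uA K j + uB K j ≤ E * a ^ (K - j) + R₁ * gs K j ^ κ₀)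
    (hvol : 0 ≤ vol) (hE : 0 ≤ E) (ha : 0 ≤ a) (hR₁ : 0 ≤ R₁) (hgs : ∀ K j, j ≤ K → 0 ≤ gs K j) (hC : 0 ≤ C)
    (hθ : 0 ≤ θ) (hΛ : 0 ≤ Λ) :
    TiltedMeanMatching l₀ T Bad F ν F' ν' (mixedEta vol E a R₁ C θ Λ κ₀ gs w) :=
  fun K t ht τ hτ s hs => (tiltedMeanMatching_of_profile hL hA hB hY hvol K t ht τ hτ s hs).trans
    (profileEta_le_mixedEta hu hvol hE ha hR₁ hgs hC hθ hΛ K)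

end Profiles

/-! ## §4 Sanity: the shapes are jointly inhabited and `tiltedMeanMatching_of_budget` fires non-vacuously

One-point field spaces, ONE class, ONE slot of scale `0` (the OLDEST slot): run A's tilted means are `0`, run B's are `a^K`
(a constant observable under a Dirac law), booked as the influence of the one slot — run B's geometric budget with `E = 1` is
then EXACTLY the old-slot price `a^{K−0}`, the young rate holds with `C = 1`, `Λ ≥ a`, and the theorem returns the (true,
non-trivial) conclusion `|a^K − 0| ≤ crossoverEta 1 0 1 1 a θ Λ 0 K`. -/

section Sanity

/-- The tilted mean of a constant observable under a Dirac law is that constant. [folklore] -/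
theorem tiltedMean_const_dirac (c s : ℝ) : tiltedMean (fun _ : Unit => c) (Measure.dirac ()) s = c := by
  unfold tiltedMean
  rw [tilted_const, integral_dirac]

/-- SANITY INSTANCE (joint inhabitation, non-vacuous firing): see the section docstring. [folklore] -/
example {a θ Λ : ℝ} (ha : 0 ≤ a) (hθ : 0 ≤ θ) (haΛ : a ≤ Λ) :
    TiltedMeanMatching (ι := Unit) 1 (fun _ => {()}) (fun _ _ => ∅) (fun (_ : ℕ) (_ : Unit) => (0 : ℝ))
      (fun _ _ => Measure.dirac ()) (fun (K : ℕ) (_ : Unit) => a ^ K) (fun _ _ => Measure.dirac ())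
      (crossoverEta 1 0 1 1 a θ Λ (fun _ => 0)) := by
  have hΛ : 0 ≤ Λ := ha.trans haΛ
  refine tiltedMeanMatching_of_budget (D := Unit) (wf := fun _ _ => {()}) (sc := fun _ _ => 0)
    (bA := fun _ _ _ _ => 0) (bB := fun _ _ _ _ => 0) (ΔA := fun _ _ _ _ _ => 0) (ΔB := fun K _ _ _ _ => a ^ K)
    ?_ ?_ ?_ ?_ zero_le_one ha hθ hΛ
  · -- the scale ledger: both tilted means are base `0` + the one slot's influence
    intro K t _ τ _ s _
    refine ⟨fun _ _ => Nat.zero_le K, ?_, ?_, by simp⟩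
    · rw [tiltedMean_const_dirac]; simp
    · rw [tiltedMean_const_dirac]; simp
  · -- run A's budget: all influences vanish
    intro K t _ τ _ s _ j _
    simp only [sub_zero, abs_zero, sum_const_zero]
    positivity
  · -- run B's budget: the one slot has scale 0 and influence a^K = 1·(1·a^(K−0))
    intro K t _ τ _ s _ j _
    rcases Nat.eq_zero_or_pos j with rfl | hj
    · simp [abs_of_nonneg (pow_nonneg ha K)]
    · have h0j : (0 : ℕ) ≠ j := (Nat.ne_of_gt hj).symm
      show ∑ X ∈ ({()} : Finset Unit) with (0 : ℕ) = j, |a ^ K - (0 : ℝ)| ≤ 1 * (1 * a ^ (K - j))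
      rw [Finset.filter_false_of_mem (fun _ _ => h0j), sum_empty]
      exact mul_nonneg zero_le_one (mul_nonneg zero_le_one (pow_nonneg ha _))
  · -- the young rate: |a^K − 0| ≤ 1·(1·(θ^0·Λ^K)) on the scale-0 slice, empty slices otherwise
    intro K t _ τ _ s _ j _
    rcases Nat.eq_zero_or_pos j with rfl | hj
    · show ∑ X ∈ ({()} : Finset Unit) with (0 : ℕ) = 0, |a ^ K - (0 : ℝ)| ≤ 1 * (1 * (θ ^ 0 * Λ ^ (K - 0)))
      rw [Finset.filter_true_of_mem (fun _ _ => rfl), sum_singleton, sub_zero, abs_of_nonneg (pow_nonneg ha K),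
        pow_zero, one_mul, one_mul, one_mul, Nat.sub_zero]
      exact pow_le_pow_left₀ ha haΛ K
    · have h0j : (0 : ℕ) ≠ j := (Nat.ne_of_gt hj).symm
      show ∑ X ∈ ({()} : Finset Unit) with (0 : ℕ) = j, |a ^ K - (0 : ℝ)| ≤ 1 * (1 * (θ ^ j * Λ ^ (K - j)))
      rw [Finset.filter_false_of_mem (fun _ _ => h0j), sum_empty]
      exact mul_nonneg zero_le_one (mul_nonneg zero_le_one (mul_nonneg (pow_nonneg hθ _) (pow_nonneg hΛ _)))

end Sanity

end Summit.QuantumFields.BalabanUV.T4Continuum.NE1p.TiltedMeanCrossover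

end
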